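import Mathlib
import Summits.Ventures.HodgeRepro2.T6N

/-!
# T6NDatum — the M2 period datum (TARGET-T6 §9.2(a))

The composition carrier of the M2 theorem `periodInputN_of_published` (TARGET-T6 §9): the admissible
auxiliary CHOICES c = (ν, K, (φ_i, q_i, p_i)_i) of TIER5 (N0.2)(q3)–(q5), the Layer-III datum `D_c :
TransferShadow F` attached to each choice, the base embedding τ₁ and the fixed generators e_{i,σ} of the
eigenlines ℓ_{i,σ} ((N0.1)(b), (q2)). The quadruple period I_σ(D, c) of (N0.1)(c) is DEFINED in the
interface's own words (`NDatum.I`), so the dictionary «S ↔ interface» is a definition, not a Prop field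
(ruling R6, TARGET-T6 §6); `Hyp.PeriodN (P.shadow c)` follows from `P.I σ c ≠ 0` by exhibiting σ and the
generators (`periodN_of_I_ne_zero`). Nothing about S, the surface maps or the automorphic side is
asserted here. §8(d): uses an L-value-free non-vanishing device: NO.
-/

namespace Summit.Ventures.HodgeRepro2.T6

variable {K : Type*} [Field K] [NumberField K]

/-- The M2 period datum over a face setting `F` (TARGET-T6 §9.2(a)): the type of admissible auxiliary
choices `c`, its admissibility predicate, the Layer-III datum `D_c` per choice, the base embedding `τ₁`
and the fixed eigenline generators `e σ i ∈ ℓ_{i,σ}`. -/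
structure NDatum (F : FaceSetting K) where
  /-- The auxiliary choices `c = (ν, K, (φ_i, q_i, p_i)_i)` of TIER5 (N0.2)(q3)–(q5). -/
  Choice : Type
  /-- Admissibility of a choice (B7(b) / Lemma A7.3(b)). -/
  AdmChoice : Choice → Prop
  /-- The Layer-III datum `D_c` (t6-p2's `shadowDataOf` through `TransferShadow.ofData`), one per choice. -/
  shadow : Choice → TransferShadow F
  /-- The base embedding `τ₁ ∈ Σ` of (N0.1). -/
  τ₁ : K →+* ℂ
  /-- The fixed generators `e_{i,σ}` of the eigenlines ((N0.1)(b), normalisation (q2)). -/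
  e : (K →+* ℂ) → Fin 4 → H1C K
  /-- `e σ i ∈ ℓ_{i,σ}`. -/
  e_mem : ∀ σ i, e σ i ∈ eigenLine K i σ

namespace NDatum

variable {F : FaceSetting K}

/-- The quadruple period `I_σ(D, c) = ∫_S f_1^*e_{1,σ} ∧ f_2^*e_{2,σ} ∧ f_3^*e_{3,σ} ∧ f_4^*e_{4,σ}` of
TIER5 (N0.1)(c), in the interface's words: `intS (pull (ι e₁ * ι e₂ * ι e₃ * ι e₄))` for `D := shadow c`. -/
noncomputable def I (P : NDatum F) (σ : K →+* ℂ) (c : P.Choice) : ℂ :=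
  (P.shadow c).intS ((P.shadow c).pull (ExteriorAlgebra.ι ℂ (P.e σ 0) * ExteriorAlgebra.ι ℂ (P.e σ 1) *
    ExteriorAlgebra.ι ℂ (P.e σ 2) * ExteriorAlgebra.ι ℂ (P.e σ 3)))

/-- `I_σ(D, c) ≠ 0` gives the displayed (N) for the datum `D_c` (witnesses `σ` and the generators
`e σ`); TIER5 (N0.2): (N_D) ⇒ (N). -/
theorem periodN_of_I_ne_zero (P : NDatum F) {σ : K →+* ℂ} {c : P.Choice} (h : P.I σ c ≠ 0) :
    Hyp.PeriodN (P.shadow c) :=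
  ⟨σ, P.e σ, P.e_mem σ, h⟩

/-- The existential form consumed by `T6Main` (TARGET-T6 §9.2(c)): a choice `c` with `I_{τ₁}(D, c) ≠ 0`
gives a datum `D_c` satisfying (N). -/
theorem exists_periodN_of_exists_I_ne_zero (P : NDatum F)
    (h : ∃ c, P.AdmChoice c ∧ P.I P.τ₁ c ≠ 0) :
    ∃ c, P.AdmChoice c ∧ Hyp.PeriodN (P.shadow c) := by
  obtain ⟨c, hc, hI⟩ := h
  exact ⟨c, hc, P.periodN_of_I_ne_zero hI⟩

end NDatum

end Summit.Ventures.HodgeRepro2.T6
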